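import Literature.MathematicalPhysics.QuantumFieldTheory.King1986.EffectiveLaplacianSymbol
import HarnessLib

/-!
# BalabanUVNodes ∕ N15 — THE KING-MODEL RUNG, FREE-FIELD EDITION (PART Τ-d): KING 1986 PROPOSITION 3.10 (3.91) **AS QUADRATIC FORMS** ON THE
# COMMON UNIT TORUS — `|⟨ψ,(Δ^{(k)} − Δ^{(k+n)})ψ⟩| ≤ θ_k⟨ψ,Δ^{(k)}ψ⟩`, `θ_k = Θ(a,L)·L^{−2k}` (the zero mode INCLUDED), the sandwich
# `δ(a,L,m²) ≤ Δ^{(k)} ≤ a`, symmetry, and the same letters for the bare action `−Δ¹ + m²` (the `k = 0` member)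
# (Track A, DAG node N15 = NE2; FAN-OUT v1.1 §N15 s3 «KING-MODEL RUNG»; regen R453 (b))

HONEST FRAMING.  Count-neutral (cell `pub-ymgap`, seat `pub-ymgap-dag-n15-e` g19; `--supports stmt-QuantumFields-27366 --as helper` = K3⁸
`SpineGivenEndpointR13SepCoPHV`).  TEMPLATE LITERATURE, `A = 0`: C. King's block-spin effective Laplacians `Δ^{(k)} = a_k − a_k²Q_kG_kQ_k^*` ([King1986]
(2.14) p. 653, (4.5) p. 670) for the FREE massive scalar field on the torus — the tree's OWN operators `King1986.Torus.effLaplacian (L^k) M a_k (L^k)² m²`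
(typer file `King1986/EffectiveLaplacianSymbol`, (4.5) as an operator identity `effLaplacian_form_DeltaEff`) — and King's Prop. 3.10 ∕ Lemma 4.3 for the
SYMBOLS (`King1986.lemma43_aK`, explicit constant).  THIS FILE transports the symbol statement to the quadratic forms of the two operators `Δ^{(k)}` (run
from `ε_K`) and `Δ^{(k+n)}` (run from `ε_{K+n}`) on the SAME unit lattice `T₁^{(k)} = Π_μ ℤ∕M_μ` (King p. 656: *"two models on the same unit lattice"*),
supplying the zero mode `p′ = 0` that `lemma43_aK` excludes (`Δ^{(k)}(0) = (a_k⁻¹ + m⁻²)⁻¹` exactly, `DeltaEff_zero`; its rate from `inv_aK_add`), and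
records the form sandwich `(a(1−L⁻²)⁻¹ + m⁻²)⁻¹·1 ≤ Δ^{(k)} ≤ a·1` (from `Σ_l|u|² = 1`, `Δ^η ≥ m²`, `Δ^{(k)} ≤ a_k ≤ a`) and the symmetry of `Δ^{(k)}` —
the hypotheses of part Τ-a's determinant-free normalisation calculus.  §7 gives the same three letters for the BARE action `c(−Δ¹) + m²` (`lapF`), the
`k = 0` member of King's (3.14).  NOT Bałaban's covariant operators; NOT a node discharge; nothing continuum-YM ∕ ℝ⁴ ∕ OS ∕ mass-gap ∕ Clay.
0 `sorry`; TWO reducible abbreviations (`kingEffLap`, `thetaK` — names for the printed objects `Δ^{(k)}`, `CL^{−2k}`) and one for the uniform constant;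
standard axioms.
HONEST SCOPE: `A = 0`, periodic b.c. (torus `Π ℤ∕M_μ`, any `M_μ ≥ 1`), `L ≥ 2`, `a > 0`, unit-lattice mass `m² > 0` (King's `m²(L^kε)²`), `k, n ≥ 1` for the
rated members; the symbol's `n`-dependence enters only through `a_n⁻¹ ≤ (a(1−L⁻²))⁻¹`, so `Θ(a,L)` is uniform in `k, n, M, m²` as Prop. 3.10 prints
(*"|Δ^{(k)}(p)| ≤ C uniformly in k, |Δ^{(k)}(p) − Δ^{(k+n)}(p)| ≤ CL^{−2k}|Δ^{(k)}(p)|"*, p. 669).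
Locators: [King1986] (2.13)–(2.14) p.653, p.656, Prop. 3.10 (3.91) p.669, (4.3)–(4.5) p.670, Lemma 4.3 (4.18) p.672, (4.35) p.674.
-/

noncomputable section

namespace Summit.QuantumFields.YangMills.BalabanUVNodes.N15KingModelRung.FreeField

open Real Finset Matrix
open Literature.MathematicalPhysics.QuantumFieldTheory.Balaban1983to89 (B4Strip.Ur B4Strip.DeltaXir B4Strip.shiftr B4Strip.Sxir B4Strip.uFactorr
  B4Strip.Ur_nonneg B4Strip.DeltaXir_nonneg B4Strip.Sxir_nonneg)
open Literature.MathematicalPhysics.QuantumFieldTheory.Balaban1983to89.B5Prop11Plancherel (Tor fine sOf abs_sOf_le sOf_ne_zero)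
open Literature.MathematicalPhysics.QuantumFieldTheory.Balaban1983to89.QGQInverse (Coercive)
open Literature.MathematicalPhysics.QuantumFieldTheory.King1986 (aK aK_pos aK_le aK_ge inv_aK_add DeltaEff DeltaEff_le DeltaEff_pos' lemma43_aK
  momSq momSq_nonneg sum_Ur_eq_one uFactorr_zero_left composedInvResc)
open Literature.MathematicalPhysics.QuantumFieldTheory.King1986.Torus (effLaplacian effLaplacian_form_DeltaEff ft parseval_dot lapF lapF_coercive
  lapF_comm lapF_transl transl_form symb_lapF lapSym fineOp fineOp_transpose Qmat)

variable {d : ℕ}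

/-! ## §1 The objects: King's `Δ^{(k)}` at unit-lattice mass `m²`, and the rate letter `θ_k` -/

/-- **King's effective Laplacian after `k ≥ 1` block-spin steps**, on the unit torus `Π_μ ℤ∕M_μ` with unit-lattice mass² `m2 = m²(L^kε)²`:
`Δ^{(k)} = a_k − a_k² Q_k G_k Q_k^*` = `effLaplacian (L^k) M a_k (L^k)² m2` ((2.14), (4.5); `a_k = aK a L k` (2.13)). Reducible name.
[cite: King1986, (2.13)–(2.14) p.653, (4.5) p.670] -/
abbrev kingEffLap (L : ℕ) [NeZero L] (M : Fin d → ℕ) [∀ μ, NeZero (M μ)] (a m2 : ℝ) (k : ℕ) : Matrix (Tor M) (Tor M) ℝ :=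
  effLaplacian (L ^ k) M (aK a L k) (((L ^ k : ℕ) : ℝ) ^ 2) m2

/-- **The rate letter** of Prop. 3.10 ∕ Lemma 4.3 with the zero mode added: `θ_k = [2a_k(a_n⁻¹ + π²∕48 + 1∕3) + a·a_n⁻¹]·L^{−2k}`
(first summand = tree `lemma43_aK`'s constant for `p′ ≠ 0`, second = the zero mode, §3). [cite: King1986, (3.91) p.669, (4.18) p.672] -/
abbrev thetaK (a : ℝ) (L : ℕ) (k n : ℕ) : ℝ :=
  (2 * aK a L k * ((aK a L n)⁻¹ + π ^ 2 / 48 + 1 / 3) + a * (aK a L n)⁻¹) * ((L : ℝ) ^ (2 * k))⁻¹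

/-- **The `(k, n)`-uniform constant** `Θ(a,L) = 2a((a(1−L⁻²))⁻¹ + π²∕48 + 1∕3) + (1−L⁻²)⁻¹` with `θ_k ≤ Θ(a,L)·L^{−2k}` (§5) — King's *"C"* of (3.91).
[cite: King1986, Prop. 3.10 p.669] -/
abbrev thetaUnif (a : ℝ) (L : ℕ) : ℝ :=
  2 * a * ((a * (1 - ((L : ℝ) ^ 2)⁻¹))⁻¹ + π ^ 2 / 48 + 1 / 3) + (1 - ((L : ℝ) ^ 2)⁻¹)⁻¹

/-! ## §2 Two letters of the symbol `Δ^{(k)}(p′) = (a_k⁻¹ + Σ_l |u(p′+l)|² Δ^η(p′+l)⁻¹)⁻¹`: its value at `p′ = 0` and its uniform floor -/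

/-- `Δ^η(l)` at the zero alias and zero momentum is the bare mass: `DeltaXir N m2 (shiftr N 0 0) = m2`. [cite: King1986, (4.4) p.670] -/
theorem DeltaXir_zero (N : ℕ) [NeZero N] (m2 : ℝ) : B4Strip.DeltaXir N m2 (B4Strip.shiftr N (fun _ : Fin d => (0 : Fin N)) 0) = m2 := by
  unfold B4Strip.DeltaXir B4Strip.shiftr B4Strip.Sxir
  simp

/-- The alias weights at zero momentum: `|u(0 + l)|² = [l = 0]`. [cite: King1986, (4.3) p.670; Balaban1983RegularityDecay, (2.45) p.584] -/
theorem Ur_zero_momentum (N : ℕ) [NeZero N] (l : Fin d → Fin N) :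
    B4Strip.Ur N l (0 : Fin d → ℝ) = if l = fun _ => (0 : Fin N) then 1 else 0 := by
  unfold B4Strip.Ur
  simp only [Pi.zero_apply, uFactorr_zero_left]
  split_ifs with hl
  · subst hl
    simp
  · obtain ⟨μ, hμ⟩ : ∃ μ, l μ ≠ 0 := by
      by_contra h
      push Not at h
      exact hl (funext h)
    apply Finset.prod_eq_zero (Finset.mem_univ μ)
    rw [if_neg]
    exact fun h0 => hμ (Fin.ext h0)

/-- **THE ZERO MODE**: `Δ^{(k)}(0) = (a_k⁻¹ + m2⁻¹)⁻¹` — independent of `N = L^k` (the zero alias carries all the weight at `p′ = 0`, and `Δ^η(0) = m²`);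
this is the momentum excluded from `lemma43_aK` (`p′ ≠ 0`) and noted in `King1986/GaussianNormalizationRate` («the zero-mode symbols are (a_k⁻¹ + M⁻¹)⁻¹»).
[cite: King1986, (4.5) p.670] -/
theorem DeltaEff_zero {a : ℝ} (N : ℕ) [NeZero N] (m2 : ℝ) : DeltaEff a N m2 (0 : Fin d → ℝ) = (a⁻¹ + m2⁻¹)⁻¹ := by
  unfold DeltaEff composedInvResc
  congr 2
  rw [Finset.sum_eq_single (fun _ : Fin d => (0 : Fin N))]
  · rw [Ur_zero_momentum, if_pos rfl, one_mul, DeltaXir_zero]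
  · intro l _ hl
    rw [Ur_zero_momentum, if_neg hl, zero_mul]
  · intro h; exact absurd (Finset.mem_univ _) h

/-- **THE UNIFORM FLOOR** `(a⁻¹ + m2⁻¹)⁻¹ ≤ Δ^{(k)}(p′)` on the Brillouin zone (`a, m2 > 0`, `N ≥ 1`): `Σ_l|u(p′+l)|² = 1` (`sum_Ur_eq_one`) and
`Δ^η(p′+l) ≥ m²`. [cite: King1986, (4.5) p.670, p.671] -/
theorem DeltaEff_ge_floor {a m2 : ℝ} (ha : 0 < a) (hm : 0 < m2) {N : ℕ} (hN : 1 ≤ N) {p : Fin d → ℝ} (hp : ∀ μ, |p μ| ≤ π) :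
    (a⁻¹ + m2⁻¹)⁻¹ ≤ DeltaEff a N m2 p := by
  haveI : NeZero N := ⟨by omega⟩
  have hpos : 0 < DeltaEff a N m2 p := DeltaEff_pos' ha N hm.le p
  have hc : 0 < composedInvResc a⁻¹ N m2 p := by
    unfold DeltaEff at hpos; exact inv_pos.mp hpos
  unfold DeltaEff
  apply inv_anti₀ hc
  unfold composedInvResc
  have hsum : ∑ m : Fin d → Fin N, B4Strip.Ur N m p * (B4Strip.DeltaXir N m2 (B4Strip.shiftr N m p))⁻¹
      ≤ ∑ m : Fin d → Fin N, B4Strip.Ur N m p * m2⁻¹ := by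
    refine Finset.sum_le_sum fun m _ => mul_le_mul_of_nonneg_left ?_ (B4Strip.Ur_nonneg N m p)
    apply inv_anti₀ hm
    unfold B4Strip.DeltaXir
    have : 0 ≤ ∑ μ, B4Strip.Sxir N (B4Strip.shiftr N m p μ) := Finset.sum_nonneg fun μ _ => B4Strip.Sxir_nonneg N _
    linarith
  rw [← Finset.sum_mul, sum_Ur_eq_one hN hp, one_mul] at hsum
  linarith

/-! ## §3 The zero-mode rate from the composition identity `a_{k+n}⁻¹ = a_k⁻¹ + L^{−2k}a_n⁻¹` -/

/-- **Prop. 3.10 at `p′ = 0`**: `|Δ^{(k)}(0) − Δ^{(k+n)}(0)| ≤ a·a_n⁻¹·L^{−2k}·Δ^{(k)}(0)` for `L ≥ 2`, `k, n ≥ 1`, `a, m2 > 0` (any `N, N′`).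
[cite: King1986, (2.13) p.653, Prop. 3.10 (3.91) p.669, (4.12) p.671] -/
theorem DeltaEff_zero_rate {a : ℝ} (ha : 0 < a) {L : ℕ} (hL : 2 ≤ L) {k n : ℕ} (hk : 1 ≤ k) (hn : 1 ≤ n) {m2 : ℝ} (hm : 0 < m2)
    (N N' : ℕ) [NeZero N] [NeZero N'] :
    |DeltaEff (aK a L k) N m2 (0 : Fin d → ℝ) - DeltaEff (aK a L (k + n)) N' m2 (0 : Fin d → ℝ)|
      ≤ a * (aK a L n)⁻¹ * ((L : ℝ) ^ (2 * k))⁻¹ * DeltaEff (aK a L k) N m2 (0 : Fin d → ℝ) := by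
  have hL1 : (1 : ℝ) < L := by exact_mod_cast hL
  have hL0 : (0 : ℝ) < L := by linarith
  rw [DeltaEff_zero, DeltaEff_zero, inv_aK_add ha hL1 k n]
  set x : ℝ := (aK a L k)⁻¹ with hx
  set r : ℝ := ((L : ℝ) ^ (2 * k))⁻¹ * (aK a L n)⁻¹ with hr
  set m : ℝ := m2⁻¹ with hmm
  have hakn : 0 < aK a L (k + n) := aK_pos ha hL1 (by omega)
  have hak : 0 < aK a L k := aK_pos ha hL1 hk
  have han : 0 < aK a L n := aK_pos ha hL1 hn
  have hxpos : 0 < x := inv_pos.mpr hak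
  have hrnn : 0 ≤ r := by rw [hr]; positivity
  have hmpos : 0 < m := inv_pos.mpr hm
  have h1 : 0 < x + m := by linarith
  have h2 : 0 < x + r + m := by linarith
  -- D₁ − D₂ = r · D₁ · D₂
  have hdiff : (x + m)⁻¹ - (x + r + m)⁻¹ = r * ((x + m)⁻¹ * (x + r + m)⁻¹) := by
    field_simp
    ring
  rw [hdiff, abs_of_nonneg (mul_nonneg hrnn (mul_nonneg (inv_nonneg.mpr h1.le) (inv_nonneg.mpr h2.le)))]
  -- D₂ ≤ a_{k+n} ≤ a, i.e. (x + r + m)⁻¹ ≤ a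
  have hD2 : (x + r + m)⁻¹ ≤ a := by
    have hakn_le : aK a L (k + n) ≤ a := aK_le ha hL1 (by omega)
    have e : (aK a L (k + n))⁻¹ = x + r := by rw [hx, hr, inv_aK_add ha hL1 k n]
    have h3 : (aK a L (k + n))⁻¹ ≤ x + r + m := by rw [e]; linarith
    calc (x + r + m)⁻¹ ≤ ((aK a L (k + n))⁻¹)⁻¹ := inv_anti₀ (inv_pos.mpr hakn) h3
      _ = aK a L (k + n) := inv_inv _
      _ ≤ a := hakn_le
  have hD1 : 0 ≤ (x + m)⁻¹ := inv_nonneg.mpr h1.le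
  calc r * ((x + m)⁻¹ * (x + r + m)⁻¹) = (r * (x + r + m)⁻¹) * (x + m)⁻¹ := by ring
    _ ≤ (r * a) * (x + m)⁻¹ := mul_le_mul_of_nonneg_right (mul_le_mul_of_nonneg_left hD2 hrnn) hD1
    _ = a * (aK a L n)⁻¹ * ((L : ℝ) ^ (2 * k))⁻¹ * (x + m)⁻¹ := by rw [hr]; ring

/-! ## §4 ★ The symbol rate at EVERY torus momentum (zero mode included) -/

/-- `p′(0) = 0`. [folklore] -/
theorem sOf_zero (M : Fin d → ℕ) [∀ μ, NeZero (M μ)] : sOf M (0 : Tor M) = 0 := by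
  funext ν; simp [sOf]

/-- A non-zero reduced momentum has positive `|p′|²`. [folklore] -/
theorem momSq_pos_of_ne_zero {p : Fin d → ℝ} (hp : p ≠ 0) : 0 < momSq p := by
  obtain ⟨μ, hμ⟩ := Function.ne_iff.mp hp
  unfold momSq
  calc (0 : ℝ) < p μ ^ 2 := by
        have : p μ ≠ 0 := hμ
        positivity
    _ ≤ ∑ ν, p ν ^ 2 := Finset.single_le_sum (f := fun ν => p ν ^ 2) (fun ν _ => sq_nonneg (p ν)) (Finset.mem_univ μ)

/-- The two partial constants are dominated by `θ_k`. [folklore] -/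
theorem lemma43_const_le_thetaK {a : ℝ} (ha : 0 < a) {L : ℕ} (hL : 2 ≤ L) {k n : ℕ} (hk : 1 ≤ k) (hn : 1 ≤ n) :
    aK a L k * (2 * (((aK a L n)⁻¹ + π ^ 2 / 48 + 1 / 3) * (((L ^ k : ℕ) : ℝ) ^ 2)⁻¹)) ≤ thetaK a L k n ∧
      a * (aK a L n)⁻¹ * ((L : ℝ) ^ (2 * k))⁻¹ ≤ thetaK a L k n := by
  have hL1 : (1 : ℝ) < L := by exact_mod_cast hL
  have hak : 0 < aK a L k := aK_pos ha hL1 hk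
  have han : 0 < aK a L n := aK_pos ha hL1 hn
  have hpow : (((L ^ k : ℕ) : ℝ) ^ 2)⁻¹ = ((L : ℝ) ^ (2 * k))⁻¹ := by
    push_cast
    rw [← pow_mul, mul_comm k 2]
  have hLi : 0 ≤ ((L : ℝ) ^ (2 * k))⁻¹ := by positivity
  have hA : 0 ≤ 2 * aK a L k * ((aK a L n)⁻¹ + π ^ 2 / 48 + 1 / 3) := by positivity
  have hB : 0 ≤ a * (aK a L n)⁻¹ := by positivity
  unfold thetaK
  rw [hpow]
  constructor
  · rw [add_mul]; nlinarith [mul_nonneg hB hLi]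
  · rw [add_mul]; nlinarith [mul_nonneg hA hLi]

/-- ★ **PROP. 3.10 (3.91) FOR THE SYMBOLS AT EVERY MOMENTUM OF THE UNIT TORUS** `Π ℤ∕M_μ`: for `L ≥ 2`, `k, n ≥ 1`, `a, m2 > 0`,
`|Δ^{(k)}(p′(q)) − Δ^{(k+n)}(p′(q))| ≤ θ_k·Δ^{(k)}(p′(q))` — `q ≠ 0` is tree `lemma43_aK` (Lemma 4.3 (4.18)), `q = 0` is §3.
[cite: King1986, Prop. 3.10 (3.91) p.669, Lemma 4.3 (4.18) p.672] -/
theorem symbol_rate_all {a : ℝ} (ha : 0 < a) {L : ℕ} [NeZero L] (hL : 2 ≤ L) {k n : ℕ} (hk : 1 ≤ k) (hn : 1 ≤ n) {m2 : ℝ} (hm : 0 < m2)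
    (M : Fin d → ℕ) [∀ μ, NeZero (M μ)] (q : Tor M) :
    |DeltaEff (aK a L k) (L ^ k) m2 (sOf M q) - DeltaEff (aK a L (k + n)) (L ^ n * L ^ k) m2 (sOf M q)|
      ≤ thetaK a L k n * DeltaEff (aK a L k) (L ^ k) m2 (sOf M q) := by
  have hL1 : (1 : ℝ) < L := by exact_mod_cast hL
  have hL0 : L ≠ 0 := by omega
  haveI : NeZero (L ^ k) := ⟨pow_ne_zero k hL0⟩
  haveI : NeZero (L ^ n * L ^ k) := ⟨mul_ne_zero (pow_ne_zero n hL0) (pow_ne_zero k hL0)⟩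
  have hak : 0 < aK a L k := aK_pos ha hL1 hk
  have hD1 : 0 ≤ DeltaEff (aK a L k) (L ^ k) m2 (sOf M q) := (DeltaEff_pos' hak (L ^ k) hm.le _).le
  obtain ⟨hc1, hc2⟩ := lemma43_const_le_thetaK ha hL hk hn
  by_cases hq : q = 0
  · subst hq
    rw [sOf_zero]
    exact (DeltaEff_zero_rate ha hL hk hn hm (L ^ k) (L ^ n * L ^ k)).trans
      (mul_le_mul_of_nonneg_right hc2 (by rw [← sOf_zero M]; exact hD1))
  · have hp0 : 0 < momSq (sOf M q) := momSq_pos_of_ne_zero (sOf_ne_zero M hq)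
    exact (lemma43_aK ha hL hk hn hm.le (abs_sOf_le M q) hp0).trans (mul_le_mul_of_nonneg_right hc1 hD1)

/-! ## §5 `θ_k ≤ Θ(a,L)·L^{−2k}` uniformly in `k, n ≥ 1` -/

/-- `1 − L⁻² > 0` for `L ≥ 2`. [folklore] -/
theorem one_sub_invSq_pos {L : ℕ} (hL : 2 ≤ L) : 0 < 1 - ((L : ℝ) ^ 2)⁻¹ := by
  have hL1 : (1 : ℝ) < L := by exact_mod_cast hL
  have h1 : (1 : ℝ) < (L : ℝ) ^ 2 := by nlinarith
  have h2 : ((L : ℝ) ^ 2)⁻¹ < 1 := inv_lt_one_of_one_lt₀ h1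
  linarith

/-- `Θ(a,L) > 0`. [folklore] -/
theorem thetaUnif_pos {a : ℝ} (ha : 0 < a) {L : ℕ} (hL : 2 ≤ L) : 0 < thetaUnif a L := by
  have h := one_sub_invSq_pos hL
  unfold thetaUnif
  positivity

/-- **`θ_k ≤ Θ(a,L)·L^{−2k}`** (`a_k ≤ a`, `a_n ≥ a(1 − L⁻²)`): King's *"uniformly in k"* ∕ *"≤ CL^{−2k}"*. [cite: King1986, (2.13) p.653, Prop. 3.10 p.669] -/
theorem thetaK_le {a : ℝ} (ha : 0 < a) {L : ℕ} (hL : 2 ≤ L) {k n : ℕ} (hk : 1 ≤ k) (hn : 1 ≤ n) :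
    thetaK a L k n ≤ thetaUnif a L * ((L : ℝ) ^ (2 * k))⁻¹ := by
  have hL1 : (1 : ℝ) < L := by exact_mod_cast hL
  have h1 := one_sub_invSq_pos hL
  have hamin : 0 < a * (1 - ((L : ℝ) ^ 2)⁻¹) := mul_pos ha h1
  have hak : aK a L k ≤ a := aK_le ha hL1 hk
  have hak0 : 0 < aK a L k := aK_pos ha hL1 hk
  have han : a * (1 - ((L : ℝ) ^ 2)⁻¹) ≤ aK a L n := aK_ge ha hL1 hn
  have han0 : 0 < aK a L n := aK_pos ha hL1 hn
  have hinv : (aK a L n)⁻¹ ≤ (a * (1 - ((L : ℝ) ^ 2)⁻¹))⁻¹ := inv_anti₀ hamin han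
  have hLi : 0 ≤ ((L : ℝ) ^ (2 * k))⁻¹ := by positivity
  unfold thetaK thetaUnif
  apply mul_le_mul_of_nonneg_right _ hLi
  have e : a * (a * (1 - ((L : ℝ) ^ 2)⁻¹))⁻¹ = (1 - ((L : ℝ) ^ 2)⁻¹)⁻¹ := by
    field_simp
  rw [← e]
  have hpos : 0 ≤ (aK a L n)⁻¹ + π ^ 2 / 48 + 1 / 3 := by positivity
  have hB : (aK a L n)⁻¹ + π ^ 2 / 48 + 1 / 3 ≤ (a * (1 - ((L : ℝ) ^ 2)⁻¹))⁻¹ + π ^ 2 / 48 + 1 / 3 := by linarith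
  have t1 : 2 * aK a L k * ((aK a L n)⁻¹ + π ^ 2 / 48 + 1 / 3) ≤ 2 * a * ((a * (1 - ((L : ℝ) ^ 2)⁻¹))⁻¹ + π ^ 2 / 48 + 1 / 3) :=
    mul_le_mul (by linarith) hB hpos (by positivity)
  have t2 : a * (aK a L n)⁻¹ ≤ a * (a * (1 - ((L : ℝ) ^ 2)⁻¹))⁻¹ := mul_le_mul_of_nonneg_left hinv ha.le
  linarith

/-! ## §6 ★★ The forms on the common unit torus: Prop. 3.10 as forms, the sandwich, symmetry -/

section Forms

variable (L : ℕ) [NeZero L] (M : Fin d → ℕ) [∀ μ, NeZero (M μ)]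

/-- `|Ω| > 0`. [folklore] -/
theorem card_tor_pos : (0 : ℝ) < Fintype.card (Tor M) := by exact_mod_cast Fintype.card_pos

/-- **(4.35) for `Δ^{(k)}`, read at `N = L^k`**: `|Ω|·⟨ψ, Δ^{(k)}ψ⟩ = Σ_q Δ^{(k)}(p′(q))|ψ̃(q)|²` (tree `effLaplacian_form_DeltaEff`).
[cite: King1986, (4.5) p.670, (4.35) p.674] -/
theorem kingEffLap_form {a : ℝ} (ha : 0 < a) (hL : 2 ≤ L) {k : ℕ} (hk : 1 ≤ k) {m2 : ℝ} (hm : 0 < m2) (ψ : Tor M → ℝ) :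
    (Fintype.card (Tor M) : ℝ) * (ψ ⬝ᵥ (kingEffLap L M a m2 k *ᵥ ψ))
      = ∑ q : Tor M, DeltaEff (aK a L k) (L ^ k) m2 (sOf M q) * ‖ft M ψ q‖ ^ 2 := by
  have hL1 : (1 : ℝ) < L := by exact_mod_cast hL
  have hN : 1 ≤ L ^ k := Nat.one_le_pow k L (by omega)
  exact effLaplacian_form_DeltaEff (L ^ k) M hN (aK_pos ha hL1 hk) hm ψ

/-- The `(k+n)`-step operator's form, with `L^{k+n}` displayed as `L^n·L^k` inside the symbol (the shape of `lemma43_aK`). [cite: King1986, (4.35) p.674] -/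
theorem kingEffLap_form_add {a : ℝ} (ha : 0 < a) (hL : 2 ≤ L) {k : ℕ} (hk : 1 ≤ k) (n : ℕ) {m2 : ℝ} (hm : 0 < m2) (ψ : Tor M → ℝ) :
    (Fintype.card (Tor M) : ℝ) * (ψ ⬝ᵥ (kingEffLap L M a m2 (k + n) *ᵥ ψ))
      = ∑ q : Tor M, DeltaEff (aK a L (k + n)) (L ^ n * L ^ k) m2 (sOf M q) * ‖ft M ψ q‖ ^ 2 := by
  rw [kingEffLap_form L M ha hL (by omega : 1 ≤ k + n) hm ψ, pow_add, mul_comm (L ^ k) (L ^ n)]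

/-- ★★ **PROPOSITION 3.10 (3.91) AS QUADRATIC FORMS ON THE COMMON UNIT LATTICE**: for `L ≥ 2`, `k, n ≥ 1`, `a, m2 > 0`, every torus `Π ℤ∕M_μ` and
every real `ψ`, `|⟨ψ, Δ^{(k)}ψ⟩ − ⟨ψ, Δ^{(k+n)}ψ⟩| ≤ θ_k·⟨ψ, Δ^{(k)}ψ⟩` (Plancherel (4.35) + §4 termwise).  This is the form of (3.91) that (3.92) and the
determinant-free (3.93) consume. [cite: King1986, Prop. 3.10 (3.91)–(3.93) p.669] -/
theorem kingEffLap_forms_rate {a : ℝ} (ha : 0 < a) (hL : 2 ≤ L) {k n : ℕ} (hk : 1 ≤ k) (hn : 1 ≤ n) {m2 : ℝ} (hm : 0 < m2) (ψ : Tor M → ℝ) :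
    |ψ ⬝ᵥ (kingEffLap L M a m2 k *ᵥ ψ) - ψ ⬝ᵥ (kingEffLap L M a m2 (k + n) *ᵥ ψ)| ≤ thetaK a L k n * (ψ ⬝ᵥ (kingEffLap L M a m2 k *ᵥ ψ)) := by
  have hc := card_tor_pos M
  -- multiply through by |Ω|
  rw [← mul_le_mul_iff_of_pos_left hc, ← abs_of_pos hc, ← abs_mul, abs_of_pos hc, mul_sub, mul_left_comm,
    kingEffLap_form L M ha hL hk hm ψ, kingEffLap_form_add L M ha hL hk n hm ψ, ← Finset.sum_sub_distrib, Finset.mul_sum]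
  refine (Finset.abs_sum_le_sum_abs _ _).trans (Finset.sum_le_sum fun q _ => ?_)
  rw [← sub_mul, abs_mul, abs_of_nonneg (by positivity : (0 : ℝ) ≤ ‖ft M ψ q‖ ^ 2), ← mul_assoc]
  exact mul_le_mul_of_nonneg_right (symbol_rate_all ha hL hk hn hm M q) (by positivity)

/-- **The upper form bound** `⟨ψ, Δ^{(k)}ψ⟩ ≤ a·⟨ψ, ψ⟩` (`Δ^{(k)}(p′) ≤ a_k ≤ a`, Parseval) — Prop. 3.10's *"|Δ^{(k)}(p)| ≤ C uniformly in k"*.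
[cite: King1986, Prop. 3.10 p.669, p.671] -/
theorem kingEffLap_form_le {a : ℝ} (ha : 0 < a) (hL : 2 ≤ L) {k : ℕ} (hk : 1 ≤ k) {m2 : ℝ} (hm : 0 < m2) (ψ : Tor M → ℝ) :
    ψ ⬝ᵥ (kingEffLap L M a m2 k *ᵥ ψ) ≤ a * (ψ ⬝ᵥ ψ) := by
  have hL1 : (1 : ℝ) < L := by exact_mod_cast hL
  have hc := card_tor_pos M
  have hak : 0 < aK a L k := aK_pos ha hL1 hk
  rw [← mul_le_mul_iff_of_pos_left hc, kingEffLap_form L M ha hL hk hm ψ, mul_left_comm, parseval_dot M ψ, Finset.mul_sum]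
  refine Finset.sum_le_sum fun q _ => mul_le_mul_of_nonneg_right ?_ (by positivity)
  exact (DeltaEff_le hak (L ^ k) hm.le _).trans (aK_le ha hL1 hk)

/-- **The floor constant** `δ(a,L,m2) = ((a(1−L⁻²))⁻¹ + m2⁻¹)⁻¹` — uniform in `k ≥ 1`. [cite: King1986, (2.13) p.653, (4.5) p.670] -/
abbrev deltaFloor (a : ℝ) (L : ℕ) (m2 : ℝ) : ℝ := ((a * (1 - ((L : ℝ) ^ 2)⁻¹))⁻¹ + m2⁻¹)⁻¹

omit [NeZero L] in
/-- `δ(a,L,m2) > 0` and `δ ≤ m2`. [folklore] -/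
theorem deltaFloor_pos_le {a : ℝ} (ha : 0 < a) (hL : 2 ≤ L) {m2 : ℝ} (hm : 0 < m2) : 0 < deltaFloor a L m2 ∧ deltaFloor a L m2 ≤ m2 := by
  have h1 := one_sub_invSq_pos hL
  have hamin : 0 < a * (1 - ((L : ℝ) ^ 2)⁻¹) := mul_pos ha h1
  refine ⟨by unfold deltaFloor; positivity, ?_⟩
  unfold deltaFloor
  calc ((a * (1 - ((L : ℝ) ^ 2)⁻¹))⁻¹ + m2⁻¹)⁻¹ ≤ (m2⁻¹)⁻¹ :=
        inv_anti₀ (inv_pos.mpr hm) (le_add_of_nonneg_left (inv_pos.mpr hamin).le)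
    _ = m2 := inv_inv m2

/-- **The coercivity** `⟨ψ, Δ^{(k)}ψ⟩ ≥ δ(a,L,m2)·⟨ψ,ψ⟩` uniformly in `k ≥ 1` (`Δ^{(k)}(p′) ≥ (a_k⁻¹ + m2⁻¹)⁻¹ ≥ δ`, Parseval).
[cite: King1986, (4.5) p.670, (4.35) p.674] -/
theorem kingEffLap_coercive {a : ℝ} (ha : 0 < a) (hL : 2 ≤ L) {k : ℕ} (hk : 1 ≤ k) {m2 : ℝ} (hm : 0 < m2) :
    Coercive (kingEffLap L M a m2 k) (deltaFloor a L m2) := by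
  intro ψ
  have hL1 : (1 : ℝ) < L := by exact_mod_cast hL
  have hc := card_tor_pos M
  have hak : 0 < aK a L k := aK_pos ha hL1 hk
  have hN : 1 ≤ L ^ k := Nat.one_le_pow k L (by omega)
  have h1 := one_sub_invSq_pos hL
  have hamin : 0 < a * (1 - ((L : ℝ) ^ 2)⁻¹) := mul_pos ha h1
  -- δ ≤ (a_k⁻¹ + m2⁻¹)⁻¹
  have hfloor : deltaFloor a L m2 ≤ ((aK a L k)⁻¹ + m2⁻¹)⁻¹ := by
    unfold deltaFloor
    apply inv_anti₀ (by positivity)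
    have : (aK a L k)⁻¹ ≤ (a * (1 - ((L : ℝ) ^ 2)⁻¹))⁻¹ := inv_anti₀ hamin (aK_ge ha hL1 hk)
    linarith
  rw [← mul_le_mul_iff_of_pos_left hc, kingEffLap_form L M ha hL hk hm ψ, mul_left_comm, parseval_dot M ψ, Finset.mul_sum]
  refine Finset.sum_le_sum fun q _ => mul_le_mul_of_nonneg_right ?_ (by positivity)
  exact hfloor.trans (DeltaEff_ge_floor hak hm hN (abs_sOf_le M q))

/-- **`Δ^{(k)}` is symmetric** (`A₀ᵀ = A₀`, tree `fineOp_transpose`). [cite: King1986, (2.14) p.653] -/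
theorem kingEffLap_transpose (a m2 : ℝ) (k : ℕ) : (kingEffLap L M a m2 k)ᵀ = kingEffLap L M a m2 k := by
  unfold kingEffLap effLaplacian
  rw [Matrix.transpose_sub, Matrix.transpose_smul, Matrix.transpose_smul, Matrix.transpose_one, Matrix.transpose_mul,
    Matrix.transpose_mul, Matrix.transpose_transpose, Matrix.transpose_nonsing_inv, fineOp_transpose, ← Matrix.mul_assoc]

end Forms

/-! ## §7 The bare action `−Δ¹ + m²` (King's (3.14) at `k = 0`): coercive, bounded, symmetric -/

section Bare

variable (M : Fin d → ℕ) [∀ μ, NeZero (M μ)]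

/-- `⟨ψ, (c(−Δ¹) + m²)ψ⟩ ≤ (m² + 4dc)⟨ψ, ψ⟩` for `c ≥ 0` (symbol `m² + cΣ_μ(2 − 2cos p′_μ) ≤ m² + 4dc`, Parseval). [cite: King1986, (4.4) p.670] -/
theorem lapF_form_le {c : ℝ} (hc : 0 ≤ c) (m2 : ℝ) (ψ : Tor M → ℝ) :
    ψ ⬝ᵥ (lapF M c m2 *ᵥ ψ) ≤ (m2 + 4 * d * c) * (ψ ⬝ᵥ ψ) := by
  have hcard := card_tor_pos M
  rw [← mul_le_mul_iff_of_pos_left hcard, transl_form M (lapF M c m2) (lapF_transl M c m2) ψ, mul_left_comm, parseval_dot M ψ,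
    Finset.mul_sum]
  refine Finset.sum_le_sum fun q _ => mul_le_mul_of_nonneg_right ?_ (by positivity)
  rw [symb_lapF]
  unfold lapSym
  have hsum : ∑ μ : Fin d, (2 - 2 * Real.cos (sOf M q μ)) ≤ ∑ _μ : Fin d, (4 : ℝ) :=
    Finset.sum_le_sum fun μ _ => by linarith [Real.neg_one_le_cos (sOf M q μ)]
  rw [Finset.sum_const, Finset.card_univ, Fintype.card_fin, nsmul_eq_mul] at hsum
  nlinarith

omit [∀ μ, NeZero (M μ)] in
/-- `c(−Δ¹) + m²` is symmetric. [folklore] -/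
theorem lapF_transpose (c m2 : ℝ) : (lapF M c m2)ᵀ = lapF M c m2 := by
  ext z z'
  rw [Matrix.transpose_apply, lapF_comm]

/-- The bare action is coercive with the common floor `δ(a,L,m2) ≤ m²`. [folklore] -/
theorem lapF_coercive_floor {a : ℝ} (ha : 0 < a) {L : ℕ} (hL : 2 ≤ L) {c : ℝ} (hc : 0 ≤ c) {m2 : ℝ} (hm : 0 < m2) :
    Coercive (lapF M c m2) (deltaFloor a L m2) := by
  intro ψ
  have h := lapF_coercive M c m2 hc ψ
  have hδ := (deltaFloor_pos_le L ha hL hm).2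
  have h0 : 0 ≤ ψ ⬝ᵥ ψ := by
    have : ψ ⬝ᵥ ψ = ∑ i, ψ i ^ 2 := by simp [dotProduct, sq]
    rw [this]; positivity
  nlinarith

end Bare

end Summit.QuantumFields.YangMills.BalabanUVNodes.N15KingModelRung.FreeField

end
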